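import Literature.MathematicalPhysics.KineticTheory.EvenCollisionTubeFunctional
import Literature.Analysis.FluidPDE.HardSphereCollisionRecord
import Literature.Analysis.FluidPDE.HardSphereRegularGeometry
import HarnessLib

/-!
# The constant-mark collision sum re-indexed by particles (helper H3 of line `Sketch`,
# crux `InformationPercolationEngine.CollisionRate`, stmt-AtomisticToContinuum-13481)

The crux statistic of `InformationPercolationEngine.CollisionRate` is the constant-mark collision sum
`K_N[χ g(σ³ρ_r)] = (ε/(N+1)) Σ_{collision times s ∈ [0,τ]} Σ_{ordered contact pairs (p,q) at s} F(s,p)`,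
`F(s,p) = χ(s, x_p(s)) g(σ³ρ_r(Φ_s z, x_p(s)))`
(`Literature.MathematicalPhysics.KineticTheory.collisionSum σ N Φ τ χ g (fun _ => 1) r z`; the mark is `≡ 1`, so the
summand only sees the first index of the ordered pair).  The line `Sketch` (card `hazard-fairness-compensator`)
consumes it RE-INDEXED BY PARTICLES:
`= (ε/(N+1)) Σ_i Σ_{s ∈ collisionTimesOf i ∩ [0,τ]} F(s,i)`.

This file proves that identity (`stub_collisionSumByParticles`, registered helper stub H3 of the lead's skeleton) by
pure finite combinatorics on the good set of the flow: for `0 < σ < 1/2` the diameter `ε = σ (N+1)^{-1/3} ≤ σ < 1/2`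
makes the torus geometry hard-sphere regular (`Torus.isHardSphereRegular_geometry`); for `z ∈ Φ.good` the orbit is a
hard-sphere trajectory, its collision times in `[0,τ]` are finitely many, at each collision time `s` the ordered contact
pairs are `(p,q)` and `(q,p)` for the colliding pair (`IsHardSphereTrajectory.contactPairs_eq_pair`) and the particles
participating at `s` are exactly `p` and `q` (`IsHardSphereTrajectory.participates_iff`).  Hence both sides are
`Σ_{s} (F(s,p_s) + F(s,q_s))` after exchanging two finite sums.

prover-line-stmt-AtomisticToContinuum-13481-0 (stub worker H3).
-/

noncomputable section

open Set
open scoped BigOperators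

namespace Summit.AtomisticToContinuum.HydrodynamicLimit.Theorems.CollisionRate

open Literature.Analysis.FluidPDE Literature.MathematicalPhysics.KineticTheory

open scoped Classical in
/-- **Exchange lemma at one collision time.**  On a hard-sphere trajectory in a regular geometry, at a collision
time `s` the inline double sum over ordered contact pairs of a summand depending on the first index only equals the
sum of that summand over the participating particles: both are `f p + f q` for the colliding pair `{p, q}`.
[folklore] -/
theorem sum_contactPairs_fst_eq_sum_filter_participates {d X : Type*} [Fintype d] [TopologicalSpace X] {M : ℕ}
    {G : Geometry d X} {ε : ℝ} {γ : ℝ → Config M d X} (hγ : IsHardSphereTrajectory G ε M γ)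
    (hG : G.IsHardSphereRegular ε) {s : ℝ} (hs : s ∈ collisionTimes G ε γ) (f : Fin M → ℝ) :
    ∑ e ∈ contactPairs G ε (γ s), f e.1 =
      ∑ i ∈ Finset.univ.filter (fun i => Participates G ε (γ s) i), f i := by
  classical
  obtain ⟨⟨p, q⟩, hpq⟩ := mem_collisionTimes_iff_contactPairs_nonempty.1 hs
  have hne : p ≠ q := (mem_contactPairs.1 hpq).1
  have hne' : (p, q) ≠ (q, p) := fun h => hne (Prod.mk.inj h).1
  have hfilter : Finset.univ.filter (fun i => Participates G ε (γ s) i) = {p, q} := by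
    ext i
    simp only [Finset.mem_filter, Finset.mem_univ, true_and, Finset.mem_insert, Finset.mem_singleton,
      hγ.participates_iff hpq]
  rw [hγ.contactPairs_eq_pair hG hpq, Finset.sum_pair hne', hfilter, Finset.sum_pair hne]

/-- **H3 · the collision sum re-indexed by particles** (registered helper stub `stub_collisionSumByParticles` of line
`Sketch` of crux `InformationPercolationEngine.CollisionRate`).  For `0 < σ < 1/2` and a good initial datum `z`, the
constant-mark collision sum `(ε/(N+1)) Σ_{collision times s ∈ [0,τ]} Σ_{ordered contact pairs (p,q)} χ(s,x_p) g(σ³ρ_r(x_p))`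
equals `(ε/(N+1)) Σ_i Σ_{s ∈ collisionTimesOf i ∩ [0,τ]} χ(s, x_i(s)) g(σ³ρ_r(Φ_s z, x_i(s)))`. [folklore] -/
theorem stub_collisionSumByParticles :
    ∀ (σ : ℝ) (N : ℕ) (Φ : HardSphereFlow (Torus.geometry (Fin 3)) (hsDiameter σ N) (N + 1))
      (τ : ℝ) (χ : ℝ × T3 → ℝ) (g : ℝ → ℝ) (r : ℝ) (z : Config (N + 1) (Fin 3) T3),
      0 < σ → σ < 1 / 2 → z ∈ Φ.good →
      Literature.MathematicalPhysics.KineticTheory.collisionSum σ N Φ τ χ g (fun _ => 1) r z =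
        hsDiameter σ N / (N + 1 : ℝ) * ∑ i : Fin (N + 1),
          ∑ᶠ s ∈ collisionTimesOf (Torus.geometry (Fin 3)) (hsDiameter σ N) (fun u => Φ.flow u z) i ∩ Set.Icc 0 τ,
            χ (s, (Φ.flow s z i).1) * g (σ ^ 3 * mollDensity r (Φ.flow s z) (Φ.flow s z i).1) := by
  intro σ N Φ τ χ g r z hσ hσ2 hz
  classical
  -- the geometry is regular at the diameter `ε ≤ σ < 1/2`, the orbit of `z` is a hard-sphere trajectory
  have hε2 : hsDiameter σ N < 2⁻¹ :=
    (hsDiameter_le hσ.le N).trans_lt (hσ2.trans_eq (one_div (2 : ℝ)))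
  have hG : (Torus.geometry (Fin 3)).IsHardSphereRegular (hsDiameter σ N) :=
    Torus.isHardSphereRegular_geometry hε2
  have htraj : IsHardSphereTrajectory (Torus.geometry (Fin 3)) (hsDiameter σ N) (N + 1) fun u => Φ.flow u z :=
    Φ.isTrajectory z hz
  have hfin : (collisionTimes (Torus.geometry (Fin 3)) (hsDiameter σ N) (fun u => Φ.flow u z) ∩ Icc 0 τ).Finite :=
    htraj.locFinite 0 τ
  -- the summand, as a function of the time and of the (first) particle
  set F : ℝ → Fin (N + 1) → ℝ := fun s i =>
    χ (s, (Φ.flow s z i).1) * g (σ ^ 3 * mollDensity r (Φ.flow s z) (Φ.flow s z i).1)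
  -- left side: the inline double sum is the sum over ordered contact pairs
  have hL : Literature.MathematicalPhysics.KineticTheory.collisionSum σ N Φ τ χ g (fun _ => 1) r z =
      hsDiameter σ N / (N + 1 : ℝ) * ∑ s ∈ hfin.toFinset,
        ∑ e ∈ contactPairs (Torus.geometry (Fin 3)) (hsDiameter σ N) (Φ.flow s z), F s e.1 := by
    simp only [Literature.MathematicalPhysics.KineticTheory.collisionSum, mul_one]
    congr 1
    rw [finsum_mem_eq_finite_toFinset_sum _ hfin]
    refine Finset.sum_congr rfl fun s _ => ?_
    rw [sum_contactPairs_eq (htraj.mem s) (fun i _ => F s i)]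
  -- right side: each particle's finsum is a sum over all collision times with the participation indicator
  have hR : ∀ i : Fin (N + 1),
      ∑ᶠ s ∈ collisionTimesOf (Torus.geometry (Fin 3)) (hsDiameter σ N) (fun u => Φ.flow u z) i ∩ Set.Icc 0 τ, F s i =
        ∑ s ∈ hfin.toFinset, if Participates (Torus.geometry (Fin 3)) (hsDiameter σ N) (Φ.flow s z) i then F s i else 0 := by
    intro i
    have hAi : (collisionTimesOf (Torus.geometry (Fin 3)) (hsDiameter σ N) (fun u => Φ.flow u z) i ∩ Icc 0 τ).Finite :=
      hfin.subset (inter_subset_inter_left _ (collisionTimesOf_subset _ i))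
    have hset : hAi.toFinset =
        hfin.toFinset.filter fun s => Participates (Torus.geometry (Fin 3)) (hsDiameter σ N) (Φ.flow s z) i := by
      ext s
      simp only [Set.Finite.mem_toFinset, Finset.mem_filter, Set.mem_inter_iff, mem_collisionTimesOf]
      exact ⟨fun h => ⟨⟨collisionTimesOf_subset _ i h.1, h.2⟩, h.1⟩, fun h => ⟨h.2, h.1.2⟩⟩
    rw [finsum_mem_eq_finite_toFinset_sum _ hAi, hset, Finset.sum_filter]
  rw [hL, Finset.sum_congr rfl fun i _ => hR i, Finset.sum_comm]
  congr 1
  refine Finset.sum_congr rfl fun s hs => ?_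
  rw [sum_contactPairs_fst_eq_sum_filter_participates htraj hG ((Set.Finite.mem_toFinset hfin).1 hs).1 (F s),
    Finset.sum_filter]

end Summit.AtomisticToContinuum.HydrodynamicLimit.Theorems.CollisionRate

end
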